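import Summits.ValiantsHypothesis.ValiantsHypothesis.Theorems.BarrierLeverDefinableEquationsDefs
import Literature.Computability.AlgebraicComplexity.ArithCircuitProofs
import Literature.Computability.AlgebraicComplexity.HamiltonianCycleVNP

/-!
# Crux `BarrierLever.DefinableEquations` (stmt-ValiantsHypothesis-8745), line `registered` —
# stub `stub_datumWitness` (V4): Valiant's criterion for ONE tableau contraction

Given the three gadgets of the line (hypotheses `signSpec`, `weightSpec`, `selSpec`: polynomials
`Gs`, `Gw k`, `Gx k` on the coefficient variables `topMonomials n` and the Boolean block
`BPos τ.D n = (block, position) × value` whose values at the one-hot point of an index function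
`i : Fin τ.D × Fin n → Fin n` are `ε_τ(i)`, the weight `∏_l e_l!` of block `k`, and the variable
`X_{e(i|k)}`), the witness of `F_τ = τ.poly` is

  `H = rename (id ⊕ ε) (V · Gs · ∏_k (Gw k · Gx k))`,   `ε : BPos τ.D n ≃ Fin (τ.D·n·n)`,

where `V = ∏_{p} ∑_{l} Z_{p,l} ∏_{l' ≠ l} (1 - Z_{p,l'})` is the recogniser of FUNCTION GRAPHS
(one-hot rows): on a Boolean point `u` it is `1` if every row `p` of `u` has exactly one `true`
(i.e. `u = oneHot i` for a unique `i`) and `0` otherwise (BCS 1997, Prop. (21.15) technique, with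
permutation matrices replaced by graphs of functions).  Hence
`boolSum H = ∑_u V(u) · (Gs · ∏_k Gw k · Gx k)(u) = ∑_i ε_τ(i) ∏_k w_k(i) X_{e(i|k)} = τ.poly`.
Size: `L(H) ≤ (B+n+2)^14 · C(2n,n)`, `deg H ≤ (B+n+2)^6` (generous; `τ.D ≤ B`, `1 ≤ n`).

References: P. Bürgisser, *Completeness and Reduction in Algebraic Complexity Theory* (2000),
Prop. 2.20 (Valiant's criterion); Bürgisser–Clausen–Shokrollahi 1997, Prop. (21.15).
-/

set_option linter.dupNamespace false

noncomputable section

namespace Summit.ValiantsHypothesis.ValiantsHypothesis.Theorems.BarrierLeverDefinableEquations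

open MvPolynomial Literature.Computability.AlgebraicComplexity
open Literature.Barriers.ValiantsHypothesis

namespace DatumWitness

/-! ### The function-graph recogniser on Boolean points -/

section Recogniser

variable {R : Type*} [CommRing R] {D n : ℕ}

/-- An index function is determined by its one-hot graph. [folklore] -/
theorem oneHot_injective : Function.Injective (oneHot (D := D) (n := n)) := by
  intro i j h
  funext p
  have h1 := congrFun h (p, j p)
  simpa [oneHot] using h1

/-- The row recogniser `∑_l u_{p,l} ∏_{l' ≠ l} (1 - u_{p,l'})` is `1` at a one-hot row.
[folklore] -/
theorem rowRecogniser_oneHot (i : Fin D × Fin n → Fin n) (p : Fin D × Fin n) :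
    ∑ l : Fin n, (if oneHot i (p, l) then (1 : R) else 0) *
        ∏ l' ∈ Finset.univ.erase l, (1 - if oneHot i (p, l') then (1 : R) else 0) = 1 := by
  rw [Finset.sum_eq_single (i p)]
  · have h1 : oneHot i (p, i p) = true := by simp [oneHot]
    rw [h1, if_pos rfl, one_mul]
    refine Finset.prod_eq_one fun l' hl' => ?_
    have h2 : oneHot i (p, l') = false := by
      simpa [oneHot] using (Finset.ne_of_mem_erase hl').symm
    rw [h2]
    simp
  · intro l _ hl
    have h2 : oneHot i (p, l) = false := by simpa [oneHot] using Ne.symm hl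
    rw [h2]
    simp
  · exact fun h => absurd (Finset.mem_univ _) h

/-- The row recogniser vanishes at a row that is not one-hot. [folklore] -/
theorem rowRecogniser_eq_zero {u : BPos D n → Bool} {p : Fin D × Fin n}
    (h : ∀ l₀ : Fin n, ∃ l, u (p, l) ≠ decide (l₀ = l)) :
    ∑ l : Fin n, (if u (p, l) then (1 : R) else 0) *
        ∏ l' ∈ Finset.univ.erase l, (1 - if u (p, l') then (1 : R) else 0) = 0 := by
  refine Finset.sum_eq_zero fun l _ => ?_
  by_cases hl : u (p, l) = true
  · obtain ⟨l', hl'⟩ := h l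
    have hne : l ≠ l' := by
      rintro rfl
      rw [hl] at hl'
      exact hl' (by simp)
    have hu : u (p, l') = true := by simpa [hne] using hl'
    rw [Finset.prod_eq_zero (Finset.mem_erase.2 ⟨fun h' => hne h'.symm, Finset.mem_univ _⟩)
      (by rw [hu, if_pos rfl, sub_self]), mul_zero]
  · rw [if_neg hl, zero_mul]

/-- The function-graph recogniser `∏_p (row recogniser)` is `1` at `oneHot i`
(BCS 1997, Prop. (21.15) technique for graphs of functions). [folklore] -/
theorem graphRecogniser_oneHot (i : Fin D × Fin n → Fin n) :
    ∏ p : Fin D × Fin n, ∑ l : Fin n, (if oneHot i (p, l) then (1 : R) else 0) *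
        ∏ l' ∈ Finset.univ.erase l, (1 - if oneHot i (p, l') then (1 : R) else 0) = 1 :=
  Finset.prod_eq_one fun p _ => rowRecogniser_oneHot i p

/-- The function-graph recogniser vanishes at every Boolean point that is not a one-hot graph.
[folklore] -/
theorem graphRecogniser_eq_zero {u : BPos D n → Bool}
    (hu : ∀ i : Fin D × Fin n → Fin n, oneHot i ≠ u) :
    ∏ p : Fin D × Fin n, ∑ l : Fin n, (if u (p, l) then (1 : R) else 0) *
        ∏ l' ∈ Finset.univ.erase l, (1 - if u (p, l') then (1 : R) else 0) = 0 := by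
  classical
  obtain ⟨p, hp⟩ : ∃ p : Fin D × Fin n, ∀ l₀ : Fin n, ∃ l, u (p, l) ≠ decide (l₀ = l) := by
    by_contra hall
    push Not at hall
    choose i hi using hall
    exact hu i (funext fun ⟨q, l⟩ => (hi q l).symm)
  exact Finset.prod_eq_zero (Finset.mem_univ p) (rowRecogniser_eq_zero hp)

/-- **Boolean sums against the function-graph recogniser are sums over index functions**:
`∑_u V(u) G(u) = ∑_i G(oneHot i)`. [folklore] -/
theorem sum_graphRecogniser_mul (G : (BPos D n → Bool) → R) :
    ∑ u : BPos D n → Bool, (∏ p : Fin D × Fin n, ∑ l : Fin n,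
        (if u (p, l) then (1 : R) else 0) *
          ∏ l' ∈ Finset.univ.erase l, (1 - if u (p, l') then (1 : R) else 0)) * G u =
      ∑ i : Fin D × Fin n → Fin n, G (oneHot i) := by
  classical
  have h : ∀ u : BPos D n → Bool, (∏ p : Fin D × Fin n, ∑ l : Fin n,
      (if u (p, l) then (1 : R) else 0) *
        ∏ l' ∈ Finset.univ.erase l, (1 - if u (p, l') then (1 : R) else 0)) * G u =
      if ∃ i : Fin D × Fin n → Fin n, oneHot i = u then G u else 0 := by
    intro u
    split_ifs with hi
    · obtain ⟨i, rfl⟩ := hi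
      rw [graphRecogniser_oneHot, one_mul]
    · push Not at hi
      rw [graphRecogniser_eq_zero hi, zero_mul]
  rw [Finset.sum_congr rfl fun u _ => h u, ← Finset.sum_filter]
  have hfi : (Finset.univ.filter fun u : BPos D n → Bool =>
      ∃ i : Fin D × Fin n → Fin n, oneHot i = u) = Finset.univ.image oneHot := by
    ext u
    simp
  rw [hfi, Finset.sum_image fun i _ j _ hij => oneHot_injective hij]

end Recogniser

/-! ### Elementary costs and the recogniser polynomial -/

/-- `L(1 - X_s) ≤ 2` (`1 - X_s = 1 + (-1)·X_s`; constants and inputs are free). [folklore] -/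
theorem complexity_one_sub_X_le {σ : Type*} (s : σ) :
    complexity (1 - X s : MvPolynomial σ ℂ) ≤ 2 := by
  have he : (1 - X s : MvPolynomial σ ℂ) = C 1 + C (-1) * X s := by
    rw [map_neg, map_one, neg_one_mul, sub_eq_add_neg]
  rw [he]
  have h1 := complexity_add_le_holds (C 1 : MvPolynomial σ ℂ) (C (-1) * X s)
  have h2 := complexity_mul_le_holds (C (-1) : MvPolynomial σ ℂ) (X s)
  have h3 := complexity_C_holds (σ := σ) (1 : ℂ)
  have h4 := complexity_C_holds (σ := σ) (-1 : ℂ)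
  have h5 := complexity_X_holds (k := ℂ) s
  omega

/-- `deg (1 - X_s) ≤ 1`. [folklore] -/
theorem totalDegree_one_sub_X_le {σ : Type*} (s : σ) :
    (1 - X s : MvPolynomial σ ℂ).totalDegree ≤ 1 := by
  refine (totalDegree_sub _ _).trans (max_le ?_ (totalDegree_X_le_one _))
  rw [totalDegree_one]
  exact Nat.zero_le _

/-- `boolSum` of a polynomial whose Boolean block `β` is enumerated by `ε : β ≃ Fin m` is the sum
of its values at the Boolean points `boolPt u`, `u : β → Bool`. [folklore] -/
theorem boolSum_rename_eq {σ β : Type*} [Fintype β] [DecidableEq β] {m : ℕ} (ε : β ≃ Fin m)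
    (G : MvPolynomial (σ ⊕ β) ℂ) :
    boolSum (rename (Sum.map id ε) G) = ∑ u : β → Bool, aeval (boolPt u) G := by
  unfold boolSum
  refine Fintype.sum_equiv ⟨fun (e : Fin m → Bool) (v : β) => e (ε v),
    fun (u : β → Bool) (j : Fin m) => u (ε.symm j), fun e => _root_.funext fun j => by simp,
    fun u => _root_.funext fun v => by simp⟩ _ _ fun e => ?_
  rw [aeval_rename]
  congr 2
  funext v
  rcases v with v | v <;> simp [boolPt]

/-- **The function-graph recogniser polynomial** `V = ∏_p ∑_l Z_{p,l} ∏_{l' ≠ l} (1 - Z_{p,l'})`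
on the Boolean block `BPos D n`: Boolean sums against it are sums over index functions, and
`L(V) ≤ 3 D n (n+1)²`, `deg V ≤ D n (n+1)`. [folklore] -/
theorem valid_spec (n D : ℕ) : ∃ V : MvPolynomial (topMonomials n ⊕ BPos D n) ℂ,
    (∀ G : (BPos D n → Bool) → MvPolynomial (topMonomials n) ℂ,
        ∑ u, aeval (boolPt u) V * G u = ∑ i : Fin D × Fin n → Fin n, G (oneHot i)) ∧
      complexity V ≤ 3 * (D * n * (n + 1) ^ 2) ∧ V.totalDegree ≤ D * n * (n + 1) := by
  refine ⟨∏ p : Fin D × Fin n, ∑ l : Fin n, X (Sum.inr (p, l)) *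
      ∏ l' ∈ Finset.univ.erase l, (1 - X (Sum.inr (p, l'))), fun G => ?_, ?_, ?_⟩
  · simp only [map_prod, map_sum, map_mul, map_sub, map_one, aeval_X, boolPt, Sum.elim_inr]
    exact sum_graphRecogniser_mul G
  · refine (complexity_prod_le_of_le _ _
      ((Finset.univ : Finset (Fin n)).card * (3 * n + 1) + (Finset.univ : Finset (Fin n)).card)
      fun p _ => complexity_sum_le_of_le _ _ _ fun l _ => ?_).trans ?_
    · have h1 := complexity_prod_le_of_le (Finset.univ.erase l)
        (fun l' => (1 - X (Sum.inr (p, l')) : MvPolynomial (topMonomials n ⊕ BPos D n) ℂ)) 2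
        fun l' _ => complexity_one_sub_X_le _
      have h2 := complexity_X_holds (k := ℂ) (Sum.inr (p, l) : topMonomials n ⊕ BPos D n)
      have h3 := complexity_mul_le_holds
        (X (Sum.inr (p, l)) : MvPolynomial (topMonomials n ⊕ BPos D n) ℂ)
        (∏ l' ∈ Finset.univ.erase l,
          (1 - X (Sum.inr (p, l')) : MvPolynomial (topMonomials n ⊕ BPos D n) ℂ))
      have h4 : (Finset.univ.erase l).card ≤ n :=
        (Finset.card_le_univ _).trans_eq (Fintype.card_fin n)
      have h5 : (Finset.univ.erase l).card * 2 + (Finset.univ.erase l).card ≤ 3 * n := by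
        omega
      omega
    · have h6 : n * (3 * n + 1) + n + 1 ≤ 3 * (n + 1) ^ 2 := by nlinarith
      have h7 : D * n * (n * (3 * n + 1) + n) + D * n ≤ 3 * (D * n * (n + 1) ^ 2) :=
        calc D * n * (n * (3 * n + 1) + n) + D * n
            = D * n * (n * (3 * n + 1) + n + 1) := by ring
          _ ≤ D * n * (3 * (n + 1) ^ 2) := Nat.mul_le_mul_left _ h6
          _ = 3 * (D * n * (n + 1) ^ 2) := by ring
      simpa only [Finset.card_univ, Fintype.card_prod, Fintype.card_fin] using h7
  · refine (totalDegree_prod_le_of_le _ _ (n + 1)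
      fun p _ => totalDegree_sum_le_of_le _ _ _ fun l _ => ?_).trans ?_
    · have h1 := totalDegree_prod_le_of_le (Finset.univ.erase l)
        (fun l' => (1 - X (Sum.inr (p, l')) : MvPolynomial (topMonomials n ⊕ BPos D n) ℂ)) 1
        fun l' _ => totalDegree_one_sub_X_le _
      have h2 := totalDegree_X_le_one (k := ℂ) (Sum.inr (p, l) : topMonomials n ⊕ BPos D n)
      have h3 := totalDegree_mul
        (X (Sum.inr (p, l)) : MvPolynomial (topMonomials n ⊕ BPos D n) ℂ)
        (∏ l' ∈ Finset.univ.erase l,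
          (1 - X (Sum.inr (p, l')) : MvPolynomial (topMonomials n ⊕ BPos D n) ℂ))
      have h4 : (Finset.univ.erase l).card ≤ n :=
        (Finset.card_le_univ _).trans_eq (Fintype.card_fin n)
      omega
    · simp only [Finset.card_univ, Fintype.card_prod, Fintype.card_fin, le_refl]

end DatumWitness

open DatumWitness in
/-- **V4 — Valiant's criterion for one tableau contraction.**  From the sign, weight and
selector gadgets of a `B`-bounded datum `τ` (hypotheses), the polynomial
`H = rename (id ⊕ ε) (V · Gs · ∏_k (Gw k · Gx k))` (`V` the function-graph recogniser,
`ε : BPos τ.D n ≃ Fin (τ.D·n·n)`) satisfies `boolSum H = τ.poly`,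
`L(H) ≤ (B+n+2)^14 · C(2n,n)` and `deg H ≤ (B+n+2)^6`. [folklore] -/
theorem stub_datumWitness :
    ∀ (n : ℕ) (τ : TabDatum n) (B : ℕ), 1 ≤ n → τ.Bounded B →
      signSpec n τ B → weightSpec n τ B → selSpec n τ B → datumWitnessSpec n τ B := by
  intro n τ B hn hB hsign hweight hsel
  obtain ⟨Gs, hGs_c, hGs_d, hGs_v⟩ := hsign
  obtain ⟨Gw, hGw⟩ := hweight
  obtain ⟨Gx, hGx⟩ := hsel
  obtain ⟨V, hV_v, hV_c, hV_d⟩ := valid_spec n τ.D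
  unfold datumWitnessSpec
  set P : ℕ := B + n + 2
  set N : ℕ := Nat.choose (2 * n) n
  have hP3 : 3 ≤ P := by omega
  have hP0 : 0 < P := by omega
  have hDP : τ.D ≤ P := by have := hB.1; omega
  have hnP : n + 1 ≤ P := by omega
  have hnP' : n ≤ P := by omega
  have hN1 : 1 ≤ N := Nat.choose_pos (by omega)
  let ε : BPos τ.D n ≃ Fin (τ.D * n * n) :=
    (Equiv.prodCongr finProdFinEquiv (Equiv.refl (Fin n))).trans finProdFinEquiv
  refine ⟨rename (Sum.map id ε) (V * Gs * ∏ k, (Gw k * Gx k)), ?_, ?_, ?_⟩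
  · -- the Boolean sum
    rw [boolSum_rename_eq]
    calc ∑ u, aeval (boolPt u) (V * Gs * ∏ k, (Gw k * Gx k))
        = ∑ u, aeval (boolPt u) V *
            (aeval (boolPt u) Gs * aeval (boolPt u) (∏ k, (Gw k * Gx k))) :=
          Finset.sum_congr rfl fun u _ => by rw [map_mul, map_mul, mul_assoc]
      _ = ∑ i : Fin τ.D × Fin n → Fin n, aeval (boolPt (oneHot i)) Gs *
            aeval (boolPt (oneHot i)) (∏ k, (Gw k * Gx k)) :=
          hV_v fun u => aeval (boolPt u) Gs * aeval (boolPt u) (∏ k, (Gw k * Gx k))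
      _ = τ.poly := by
          unfold TabDatum.poly
          refine Finset.sum_congr rfl fun i _ => ?_
          rw [map_prod, hGs_v i, smul_eq_C_mul]
          refine congrArg _ (Finset.prod_congr rfl fun k _ => ?_)
          rw [map_mul, (hGw k).2.2 i, (hGx k).2.2 i, smul_eq_C_mul]
  · -- the size
    refine (complexity_rename_le_holds' _ _).trans ?_
    have c1 := complexity_mul_le_holds (V * Gs) (∏ k, (Gw k * Gx k))
    have c2 := complexity_mul_le_holds V Gs
    have c3 : complexity (∏ k, (Gw k * Gx k)) ≤ P ^ 5 + P ^ 5 * N + 2 * P := by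
      calc complexity (∏ k, (Gw k * Gx k))
          ≤ (Finset.univ : Finset (Fin τ.D)).card * (P ^ 4 + P ^ 4 * N + 1) +
              (Finset.univ : Finset (Fin τ.D)).card :=
            complexity_prod_le_of_le _ _ _ fun k _ => (complexity_mul_le_holds _ _).trans (by
              have h1 := (hGw k).1
              have h2 := (hGx k).1
              omega)
        _ = τ.D * (P ^ 4 + P ^ 4 * N + 1) + τ.D := by rw [Finset.card_univ, Fintype.card_fin]
        _ ≤ P * (P ^ 4 + P ^ 4 * N + 1) + P := by gcongr
        _ = P ^ 5 + P ^ 5 * N + 2 * P := by ring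
    have c4 : complexity V ≤ P ^ 5 := by
      calc complexity V ≤ 3 * (τ.D * n * (n + 1) ^ 2) := hV_c
        _ ≤ 3 * (P * P * P ^ 2) := by gcongr
        _ = 3 * P ^ 4 := by ring
        _ ≤ P * P ^ 4 := Nat.mul_le_mul_right _ hP3
        _ = P ^ 5 := by ring
    have f1 : 2 * P + 2 ≤ P ^ 5 := by
      calc 2 * P + 2 ≤ 3 * P := by omega
        _ ≤ P * P := Nat.mul_le_mul_right _ hP3
        _ = P ^ 2 := (sq P).symm
        _ ≤ P ^ 5 := Nat.pow_le_pow_right hP0 (by norm_num)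
    have f2 : 3 * P ^ 5 ≤ P ^ 12 := by
      calc 3 * P ^ 5 ≤ P * P ^ 5 := Nat.mul_le_mul_right _ hP3
        _ = P ^ 6 := by ring
        _ ≤ P ^ 12 := Nat.pow_le_pow_right hP0 (by norm_num)
    have f3 : P ^ 12 ≤ P ^ 12 * N := Nat.le_mul_of_pos_right _ hN1
    have f4 : P ^ 5 * N ≤ P ^ 12 * N :=
      Nat.mul_le_mul_right _ (Nat.pow_le_pow_right hP0 (by norm_num))
    have f5 : 3 * (P ^ 12 * N) ≤ P ^ 14 * N := by
      have h9 : 3 ≤ P ^ 2 := hP3.trans (by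
        calc P = P ^ 1 := (pow_one P).symm
          _ ≤ P ^ 2 := Nat.pow_le_pow_right hP0 (by norm_num))
      calc 3 * (P ^ 12 * N) ≤ P ^ 2 * (P ^ 12 * N) := Nat.mul_le_mul_right _ h9
        _ = P ^ 14 * N := by ring
    omega
  · -- the degree
    refine (totalDegree_rename_le _ _).trans ?_
    have d1 := totalDegree_mul (V * Gs) (∏ k, (Gw k * Gx k))
    have d2 := totalDegree_mul V Gs
    have d3 : (∏ k, (Gw k * Gx k)).totalDegree ≤ P ^ 3 + P ^ 4 := by
      calc (∏ k, (Gw k * Gx k)).totalDegree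
          ≤ (Finset.univ : Finset (Fin τ.D)).card * (P ^ 2 + P ^ 3) :=
            totalDegree_prod_le_of_le _ _ _ fun k _ => (totalDegree_mul _ _).trans
              (add_le_add (hGw k).2.1 (hGx k).2.1)
        _ = τ.D * (P ^ 2 + P ^ 3) := by rw [Finset.card_univ, Fintype.card_fin]
        _ ≤ P * (P ^ 2 + P ^ 3) := by gcongr
        _ = P ^ 3 + P ^ 4 := by ring
    have d4 : V.totalDegree ≤ P ^ 3 := by
      calc V.totalDegree ≤ τ.D * n * (n + 1) := hV_d
        _ ≤ P * P * P := by gcongr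
        _ = P ^ 3 := by ring
    have f1 : 2 * P ^ 3 ≤ P ^ 4 := by
      calc 2 * P ^ 3 ≤ P * P ^ 3 := Nat.mul_le_mul_right _ (by omega)
        _ = P ^ 4 := by ring
    have f2 : 3 * P ^ 4 ≤ P ^ 6 := by
      calc 3 * P ^ 4 ≤ P * P ^ 4 := Nat.mul_le_mul_right _ hP3
        _ = P ^ 5 := by ring
        _ ≤ P ^ 6 := Nat.pow_le_pow_right hP0 (by norm_num)
    omega

end Summit.ValiantsHypothesis.ValiantsHypothesis.Theorems.BarrierLeverDefinableEquations

end
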